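import Summits.AtomisticToContinuum.BoseEinsteinCondensation.Theorems.KineticLatticeBEC.Negative.Toolkit

/-!
# Negative lemmas for crux `KineticLatticeBEC` (stmt-AtomisticToContinuum-9671), II: the filling
restriction `2N ≤ L³` is load-bearing

Supports (does not close) stmt-AtomisticToContinuum-9671. Relax `2 * N ≤ L ^ 3` to `N ≤ L ^ 3`
("uniform BEC at every filling") and the statement is FALSE (`kineticLatticeBEC_false_without_halfFilling`):
at `N = L³` the ground space of `H_pen(L,L³)` is the ray of the all-up vector
(`eq_smul_upVec_of_mem_groundSpace_full`, from the master inequality), `Re ω(O) ≤ L³/2`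
(`re_gsf_obsO_full_le`) and `rhs(L,L³) ≤ L³ = N` (`rhs_full_le`, i.e. `N₀ ≤ 1`), so `c L³ ≤ 1` on every
large even torus. Any proof of the crux must use the filling cap.
-/

noncomputable section

namespace Summit.AtomisticToContinuum.BoseEinsteinCondensation.Theorems.KineticLatticeBEC.Negative

open scoped BigOperators ComplexOrder
open Literature.MathematicalPhysics.QuantumLattice Literature.Probability.LatticeModels Matrix Finset
open Summit.AtomisticToContinuum.BoseEinsteinCondensation.Theses.BECStronglyRayleigh
open Summit.AtomisticToContinuum.BoseEinsteinCondensation.Theorems.LatticeODLROOffHalfFilling.Negative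

section FullFilling

variable (L : ℕ) [NeZero L]

/-- **At full filling the ground space is the all-up ray.** For `N = L³` every ground vector of
`H_pen(L,L³)` is a multiple of `|⇑⟩` (from (★): `Σ_σ #↓σ ‖v σ‖² ≤ Re⟨v,H_pen v⟩ = E₀‖v‖² ≤ 0`).
[folklore] -/
theorem eq_smul_upVec_of_mem_groundSpace_full (hL : 3 ≤ L)
    {v : TensorIndex (TorusSite 3 L) 2 → ℂ} (hv : v ∈ (Hpen L (L ^ 3)).groundSpace) :
    v = v (fun _ => 0) • upVec := by
  have hE := groundEnergy_Hpen_le L hL (L ^ 3)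
  have hE0 : (Hpen L (L ^ 3)).groundEnergy ≤ 0 := by
    have : ((L : ℝ) ^ 3 - ((L ^ 3 : ℕ) : ℝ)) = 0 := by push_cast; ring
    rw [this] at hE
    simpa using hE
  rw [mem_groundSpace_iff] at hv
  have hvv : 0 ≤ (star v ⬝ᵥ v).re := (Complex.nonneg_iff.mp (dotProduct_star_self_nonneg _)).1
  have hquad : (star v ⬝ᵥ (Hpen L (L ^ 3)) *ᵥ v).re ≤ 0 := by
    rw [hv, dotProduct_smul, smul_eq_mul, Complex.re_ofReal_mul]
    exact mul_nonpos_of_nonpos_of_nonneg hE0 hvv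
  have hM := re_quad_Hpen_ge L hL (L ^ 3) v
  have hL1 : (1 : ℝ) ≤ (L : ℝ) ^ 3 :=
    one_le_pow₀ (by exact_mod_cast (le_trans (by norm_num : 1 ≤ 3) hL))
  have hterm : ∀ σ : TensorIndex (TorusSite 3 L) 2, (downCount σ : ℝ) * ‖v σ‖ ^ 2 ≤
      (4 * (L : ℝ) ^ 3 * ((L : ℝ) ^ 3 - ((L ^ 3 : ℕ) : ℝ) - downCount σ) ^ 2 - 3 * downCount σ) *
        ‖v σ‖ ^ 2 := by
    intro σ
    have hn : 0 ≤ ‖v σ‖ ^ 2 := sq_nonneg _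
    apply mul_le_mul_of_nonneg_right _ hn
    have hcast : ((L : ℝ) ^ 3 - ((L ^ 3 : ℕ) : ℝ) - downCount σ) ^ 2 = (downCount σ : ℝ) ^ 2 := by
      push_cast; ring
    rw [hcast]
    rcases Nat.eq_zero_or_pos (downCount σ) with h0 | hpos
    · rw [h0]; simp
    · have hk : (1 : ℝ) ≤ downCount σ := by exact_mod_cast hpos
      nlinarith
  have hsum : ∑ σ, (downCount σ : ℝ) * ‖v σ‖ ^ 2 ≤ 0 :=
    (Finset.sum_le_sum fun σ _ => hterm σ).trans (hM.trans hquad)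
  have hnn : ∀ σ ∈ (Finset.univ : Finset (TensorIndex (TorusSite 3 L) 2)),
      0 ≤ (downCount σ : ℝ) * ‖v σ‖ ^ 2 := fun σ _ =>
    mul_nonneg (Nat.cast_nonneg _) (sq_nonneg _)
  have hzero := (Finset.sum_eq_zero_iff_of_nonneg hnn).mp (le_antisymm hsum (Finset.sum_nonneg hnn))
  funext τ
  by_cases hτ : τ = fun _ => 0
  · subst hτ
    simp [upVec]
  · have hk : downCount τ ≠ 0 := fun h => hτ ((downCount_eq_zero_iff τ).mp h)
    have hkpos : (0 : ℝ) < downCount τ := by exact_mod_cast Nat.pos_of_ne_zero hk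
    have h := hzero τ (Finset.mem_univ τ)
    have hn : ‖v τ‖ ^ 2 = 0 := by
      rcases mul_eq_zero.mp h with h | h
      · exact absurd h hkpos.ne'
      · exact h
    have hv0 : v τ = 0 := by
      have : ‖v τ‖ = 0 := by
        have := sq_eq_zero_iff.mp hn
        exact this
      exact norm_eq_zero.mp this
    rw [hv0, Pi.smul_apply, upVec, Pi.single_apply, if_neg hτ, smul_zero]

/-- **`Re ω(O) ≤ L³/2` at full filling** (positivity transfer of `(L³/2)·1 − O ≥ 0` on the ground
space, where it vanishes identically). [folklore] -/
theorem re_gsf_obsO_full_le (hL : 3 ≤ L) :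
    ((Hpen L (L ^ 3)).groundStateFunctional (obsO (TorusSite 3 L))).re ≤ (L : ℝ) ^ 3 / 2 := by
  have hT : ∀ v ∈ (Hpen L (L ^ 3)).groundSpace,
      0 ≤ (star v ⬝ᵥ ((((L : ℝ) ^ 3 / 2 : ℝ) : ℂ) • (1 : Op (TorusSite 3 L) 2) -
        obsO (TorusSite 3 L)) *ᵥ v).re := by
    intro v hv
    obtain ⟨a, rfl⟩ : ∃ a : ℂ, v = a • upVec :=
      ⟨v (fun _ => 0), eq_smul_upVec_of_mem_groundSpace_full L hL hv⟩
    rw [sub_mulVec, dotProduct_sub, Complex.sub_re, smul_mulVec, one_mulVec, dotProduct_smul,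
      smul_eq_mul, Complex.re_ofReal_mul, re_quad_obsO_smul_upVec, card_site]
    push_cast
    linarith
  have h := re_gsf_nonneg_of_groundSpace hT
  rw [map_sub, map_smul, groundStateFunctional_one (Hpen_isHermitian L _), Complex.sub_re,
    smul_eq_mul, mul_one, Complex.ofReal_re] at h
  linarith

/-- **`rhs(L, L³) ≤ L³`**: at full filling the order parameter is `⟨S⁺_totS⁻_tot⟩ ≤ L³ = N`
(`N₀ ≤ 1`). [folklore] -/
theorem rhs_full_le (hL : 3 ≤ L) : rhs L (L ^ 3) ≤ (L : ℝ) ^ 3 := by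
  have h := re_gsf_obsO_full_le L hL
  rw [rhs]
  push_cast
  linarith

end FullFilling

/-- The crux with the half-filling restriction `2 * N ≤ L ^ 3` relaxed to `N ≤ L ^ 3`
("uniform BEC at EVERY filling"); everything else verbatim. -/
def KineticLatticeBECWithoutHalfFilling : Prop :=
  ∃ c : ℝ, 0 < c ∧ ∃ L₀ : ℕ, ∀ (L : ℕ) [NeZero L], L₀ ≤ L → Even L → ∀ N : ℕ, 1 ≤ N → N ≤ L ^ 3 →
    c * N * (L : ℝ) ^ 3 ≤ rhs L N

/-- **(a) The filling restriction is load-bearing**: uniform BEC at every filling `N ≤ L³` is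
FALSE — witness `N = L³` on any even torus with `c L³ > 1` (`rhs_full_le`). Any proof of the crux
must use `2N ≤ L³` (or at least `N ≤ (1 − δ)L³`). [folklore] -/
theorem kineticLatticeBEC_false_without_halfFilling : ¬ KineticLatticeBECWithoutHalfFilling := by
  rintro ⟨c, hc, L₀, h⟩
  obtain ⟨m, hm⟩ := exists_nat_gt (1 / c)
  have hL0 : (2 * (L₀ + m + 2)) ≠ 0 := by omega
  haveI : NeZero (2 * (L₀ + m + 2)) := ⟨hL0⟩
  have hL3 : 3 ≤ 2 * (L₀ + m + 2) := by omega
  have hN1 : 1 ≤ (2 * (L₀ + m + 2)) ^ 3 := Nat.one_le_pow _ _ (by omega)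
  have key := h (2 * (L₀ + m + 2)) (by omega) ⟨L₀ + m + 2, by ring⟩ ((2 * (L₀ + m + 2)) ^ 3) hN1 le_rfl
  have hr := rhs_full_le (2 * (L₀ + m + 2)) hL3
  set x : ℝ := ((2 * (L₀ + m + 2) : ℕ) : ℝ) with hx
  have hxm : (m : ℝ) + 1 ≤ x := by
    rw [hx]; push_cast; linarith
  have hx1 : (1 : ℝ) ≤ x := by
    have : (0 : ℝ) ≤ m := Nat.cast_nonneg _
    linarith
  have hcm : 1 < c * m := by
    rw [div_lt_iff₀ hc] at hm
    linarith
  rw [Nat.cast_pow] at key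
  rw [← hx] at key
  -- key : c * x^3 * x^3 ≤ rhs;  hr : rhs ≤ x^3
  have hx3 : (0 : ℝ) < x ^ 3 := by positivity
  have h1 : c * x ^ 3 ≤ 1 := by
    by_contra hcon
    push Not at hcon
    have : x ^ 3 < c * x ^ 3 * x ^ 3 := by nlinarith
    linarith
  have h2 : x ≤ x ^ 3 := le_self_pow₀ hx1 (by norm_num)
  nlinarith [mul_le_mul_of_nonneg_left h2 hc.le, mul_le_mul_of_nonneg_left hxm hc.le]



end Summit.AtomisticToContinuum.BoseEinsteinCondensation.Theorems.KineticLatticeBEC.Negative
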